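import Summits.FinalStateConjecture.FinalStateConjecture.Theorems.ClusterCompletenessOmegaLimitMultiKerrBackgroundOmegaLimits
import Summits.FinalStateConjecture.FinalStateConjecture.Theorems.ClusterCompletenessOmegaLimitMultiKerrTranslates
import Literature.Geometry.Lorentzian.NearKerrLeaf
import Literature.Geometry.Lorentzian.KerrSchildChartCovariance
import HarnessLib

/-!
# Route ClusterCompleteness · crux `OmegaLimitMultiKerr` — on the horizon-penetrating (star) chart
# the CLOSED truncated slabs are compact: flat ω-limits ARE recurrence at every exterior radius

Structure lemmas for the crux stmt-FinalStateConjecture-14664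
(`ClusterCompleteness.OmegaLimitMultiKerr`), line `Sketch`, lead gen 4, stub `PenetratingSlab`
(registered main theorem
`tendsto_supCkENorm_truncTimeSlab_translate_of_iteratedFDeriv_eq_zero_closedSlab`, closed form).

The landed ω-limit dictionary (`ClusterCompletenessOmegaLimitMultiKerrBackgroundOmegaLimits`):
recurrence at EVERY radius along the times `T n` (the `Cᵏ` sup norms of the translates
`h (· + T n • e)` over the time-zero truncated slabs tend to `0`) forces every ω-limit `g` of the
translates to be flat to order `k` on the time-zero slab
(`iteratedFDeriv_omegaLimit_eq_zero_of_tendsto_supCkENorm_truncTimeSlab`); CONVERSELY a flat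
ω-limit gives recurrence on every COMPACT subset of the domain (`Cᵏ_loc` currency;
`tendsto_supCkENorm_translate_of_iteratedFDeriv_omegaLimit_eq_zero`). For the crux's hole charts on
`boostedKerrBackground Λ c M a` (domain the boosted exterior `{r(Λ⁻¹(x − c)) > max r₊ 0}`, OPEN at
the horizon) the truncated slab `{t* = 0, r₊ < r ≤ R'}` is not compact in the domain (it
accumulates at `{r = r₊}`), so the converse does not give back the crux's recurrence clause (the
"one asymmetry" recorded in `ClusterCompletenessOmegaLimitMultiKerrHoleOmegaLimits`). On the
horizon-PENETRATING star background `starBackground Λ c M a rf` (`NearKerrLeaf`; domain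
`{r(Λ⁻¹(x − c)) > max M 0}`, same form and time) the CLOSED slab `{t* = τ, r₊ ≤ r ≤ R'}` IS a
compact subset of the domain for sub-extremal labels (`r₊ = M + √(M² − a²) > M > 0`). This file
makes this precise and upgrades the dictionary to an EQUIVALENCE on such "margin" charts:

* `isCompact_closedTruncSlab` — `{x | t*(x) = τ, r₊ ≤ r(Λ⁻¹(x − c)) ≤ R'}` is compact (preimage
  under the affine homeomorphism `poincareInv Λ c` of the closed bounded rest-frame slab
  `{y⁰ = τ, r₊ ≤ r_a(y) ≤ R'}`: `|y⃗|² ≤ r² + a²`); no label hypothesis is needed;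
* `closedTruncSlab_subset_starBackground_domain` — for `Kerr.IsSubextremal M a` it lies in the
  star domain `{r > max M 0}` (`M < r₊`); `image_truncTimeSlab_subset_closedTruncSlab` — it
  contains the exterior truncated slab `{t* = τ, r₊ < r ≤ R'}` of `boostedKerrBackground Λ c M a`;
  `add_smul_mem_starBackground_domain` — the star domain is invariant under `x ↦ x + s • Λ∂₀`;
* `radius_lt_radius_smul` — the Kerr–Schild radius increases strictly under the dilations
  `y ↦ s • y`, `s > 1`, where `r_a(y) > |a|` (its level sets are confocal ellipsoids), whence
  `iteratedFDeriv_eq_zero_closedSlab_of_eq_zero_timeSlab` — a `Cᵏ` field on the star domain that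
  is flat to order `k` on the OPEN exterior slab `{t* = 0, r > r₊}` (where the dictionary's forward
  direction delivers flatness) is flat on the CLOSED slab `{t* = 0, r ≥ r₊}` (continuity);
* `tendsto_supCkENorm_truncTimeSlab_translate_iff_iteratedFDeriv_eq_zero_timeSlab` — the
  EQUIVALENCE: for `h ∈ C^{k+1}`, `g ∈ Cᵏ` on the star domain with `h (· + T n • Λ∂₀) → g` in
  `Cᵏ` on its compacts, recurrence at every exterior radius along `T` holds iff `g` is flat to
  order `k` on the exterior time-zero slab; its backward direction under closed-slab flatness is
  the registered `tendsto_supCkENorm_truncTimeSlab_translate_of_iteratedFDeriv_eq_zero_closedSlab`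
  (restriction to the exterior slab only LOWERS the sups, `supCkENorm_mono`).

LaSalle reading of the recur-disjunct: Hale 1980, Ch. I, §8; `Cᵏ` Arzelà–Ascoli currency: Petersen
2006, Ch. 10, §3.1; Kerr-star coordinates regular across `𝓗⁺`: Dafermos–Rodnianski 2008, §5.1.
Everything is proved; Mathlib + `Literature` + landed `Theorems` files only, no definitions.
-/

-- every `Summit.FinalStateConjecture.FinalStateConjecture.…` name repeats the summit = sub-problem segment (D-0017 layout)
set_option linter.dupNamespace false

noncomputable section

open scoped Manifold ContDiff Topology ENNReal
open Set Filter TopologicalSpace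

namespace Summit.FinalStateConjecture.FinalStateConjecture.Theorems.ClusterCompleteness

open Literature.Geometry.Lorentzian

/-! ### The closed truncated slabs of the boosted Kerr-star chart -/

/-- **The closed truncated slab `{t* = τ, r₊ ≤ r ≤ R'}` of a boosted Kerr chart is compact.**
Here `t*(x) = (Λ⁻¹(x − c))⁰` and `r = r_a(Λ⁻¹(x − c))` are the rest-frame Kerr–Schild time and
radius. The set is the preimage under the affine homeomorphism `poincareInv Λ c = (x ↦ Λ⁻¹(x − c))`
of the rest-frame slab `{y | y⁰ = τ, r₊ ≤ r_a(y) ≤ R'}`, which is closed (`Kerr.continuous_radius`)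
and bounded (`‖y‖² = (y⁰)² + |y⃗|²`, `|y⃗|² ≤ r_a(y)² + a² ≤ R'² + a²` by
`Kerr.spatialNorm_sq_sub_sq_le_radius_sq`), hence compact. No hypothesis on the label is needed;
these are the compact truncated leaves `Σ_τ ∩ {r ≤ R'}` of the Kerr-star foliation
(Dafermos–Rodnianski 2008, §5.1). [folklore] -/
theorem isCompact_closedTruncSlab (Λ : lorentzGroup) (c : E4) (M a τ R' : ℝ) :
    IsCompact {x : E4 | poincareInv Λ c x 0 = τ ∧
      Kerr.rPlus M a ≤ Kerr.radius a (poincareInv Λ c x) ∧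
        Kerr.radius a (poincareInv Λ c x) ≤ R'} := by
  -- the rest-frame slab `S = {y⁰ = τ, r₊ ≤ r_a(y) ≤ R'}` is closed and bounded, hence compact
  obtain ⟨S, hS⟩ : ∃ S : Set E4,
      S = {y : E4 | y 0 = τ ∧ Kerr.rPlus M a ≤ Kerr.radius a y ∧ Kerr.radius a y ≤ R'} := ⟨_, rfl⟩
  have hSc : IsClosed S := by
    rw [hS, setOf_and, setOf_and]
    exact (isClosed_eq (PiLp.continuous_apply 2 _ 0) continuous_const).inter
      ((isClosed_le continuous_const (Kerr.continuous_radius a)).inter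
        (isClosed_le (Kerr.continuous_radius a) continuous_const))
  have hSb : Bornology.IsBounded S := by
    rw [isBounded_iff_forall_norm_le]
    refine ⟨√(τ ^ 2 + (R' ^ 2 + a ^ 2)), fun y hy ↦ Real.le_sqrt_of_sq_le ?_⟩
    rw [hS] at hy
    obtain ⟨h0, -, hR⟩ := hy
    have h1 := Kerr.spatialNorm_sq_sub_sq_le_radius_sq a y
    have h2 : Kerr.radius a y ^ 2 ≤ R' ^ 2 := pow_le_pow_left₀ (Kerr.radius_nonneg a y) hR 2
    have h3 : ‖y‖ ^ 2 = y 0 ^ 2 + E4.spatialNorm y ^ 2 := by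
      rw [EuclideanSpace.norm_sq_eq, Fin.sum_univ_four, E4.spatialNorm_sq]
      simp only [Real.norm_eq_abs, sq_abs]
      ring
    rw [h3, h0]; linarith
  -- the slab is the preimage of `S` under the homeomorphism `x ↦ Λ⁻¹(x − c)`
  obtain ⟨e, he⟩ : ∃ e : E4 ≃ₜ E4, (e : E4 → E4) = poincareInv Λ c :=
    ⟨(Homeomorph.subRight c).trans (Λ : E4 ≃L[ℝ] E4).symm.toHomeomorph, rfl⟩
  have hK : IsCompact (poincareInv Λ c ⁻¹' S) :=
    he ▸ e.isCompact_preimage.2 (Metric.isCompact_of_isClosed_isBounded hSc hSb)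
  rw [hS] at hK
  exact hK

/-- **For sub-extremal labels the closed truncated slab lies in the star domain**:
`{t* = τ, r₊ ≤ r ≤ R'} ⊆ {r > max M 0} = (starBackground Λ c M a rf).domain`, because
`0 < M < r₊ = M + √(M² − a²)` when `|a| < M` (`Kerr.IsSubextremal.M_lt_rPlus`; the star region is a
neighbourhood of the future event horizon `{r = r₊}`, across which the Kerr-star chart is regular;
Dafermos–Rodnianski 2008, §5.1). [cite: DafermosRodnianski2008, §5.1] -/
theorem closedTruncSlab_subset_starBackground_domain (Λ : lorentzGroup) (c : E4) {M a : ℝ}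
    (hMa : Kerr.IsSubextremal M a) (rf : E4 → ℝ) (τ R' : ℝ) :
    {x : E4 | poincareInv Λ c x 0 = τ ∧ Kerr.rPlus M a ≤ Kerr.radius a (poincareInv Λ c x) ∧
        Kerr.radius a (poincareInv Λ c x) ≤ R'} ⊆
      ((starBackground Λ c M a rf).domain : Set E4) := by
  intro x hx
  rw [SetLike.mem_coe, mem_starBackground_domain, Kerr.mem_region, max_eq_left hMa.pos.le]
  exact hMa.M_lt_rPlus.trans_le hx.2.1

/-- **The closed truncated slab contains the exterior truncated slab** of the boosted Kerr
background: `{t* = τ, r ≤ R'} ∩ {r > max r₊ 0} ⊆ {t* = τ, r₊ ≤ r ≤ R'}` (time, radius, domain of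
`boostedKerrBackground Λ c M a`: `(Λ⁻¹(x − c))⁰`, `r_a(Λ⁻¹(x − c))`, `{r > max r₊ 0}`).
[folklore] -/
theorem image_truncTimeSlab_subset_closedTruncSlab (Λ : lorentzGroup) (c : E4) (M a R' τ : ℝ) :
    Subtype.val '' (boostedKerrBackground Λ c M a).truncTimeSlab R' τ ⊆
      {x : E4 | poincareInv Λ c x 0 = τ ∧ Kerr.rPlus M a ≤ Kerr.radius a (poincareInv Λ c x) ∧
        Kerr.radius a (poincareInv Λ c x) ≤ R'} := by
  rintro _ ⟨y, hy, rfl⟩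
  rw [ModelBackground.mem_truncTimeSlab] at hy
  have hy2 : poincareInv Λ c y ∈ Kerr.region a (Kerr.rPlus M a) := y.2
  exact ⟨hy.1, (Kerr.lt_radius_of_mem_region hy2).le, hy.2⟩

/-- **The star domain is invariant under the Killing translation** `x ↦ x + s • Λ∂₀`, `s ∈ ℝ`:
the rest-frame radius `r_a(Λ⁻¹(x − c))` is invariant (`KerrSchildChart.radius_add_smul`) and the
domain is `{r > max M 0}` (Kerr–Schild 1965, §2: `∂_{t*}` is Killing; the invariance hypothesis of
the ω-limit dictionary, cf. `add_smul_mem_boostedKerrBackground_domain`).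
[cite: KerrSchild1965, §2] -/
theorem add_smul_mem_starBackground_domain (Λ : lorentzGroup) (c : E4) (M a : ℝ) (rf : E4 → ℝ) :
    ∀ x ∈ ((starBackground Λ c M a rf).domain : Set E4), ∀ s : ℝ,
      x + s • (Λ : E4 ≃L[ℝ] E4) (EuclideanSpace.single (0 : Fin 4) (1 : ℝ)) ∈
        ((starBackground Λ c M a rf).domain : Set E4) := by
  intro x hx s
  have h : Kerr.radius a (poincareInv Λ c
      (x + s • (Λ : E4 ≃L[ℝ] E4) (EuclideanSpace.single (0 : Fin 4) (1 : ℝ)))) =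
      Kerr.radius a (poincareInv Λ c x) :=
    KerrSchildChart.radius_add_smul Λ c M a x s
  rw [SetLike.mem_coe, mem_starBackground_domain, Kerr.mem_region] at hx ⊢
  rwa [h]

/-! ### From the open exterior slab to the closed slab: dilations and continuity -/

/-- **The Kerr–Schild radius increases strictly under spatial dilation.** If `|a| < r_a(y)` and
`s > 1` then `r_a(y) < r_a(s • y)`. For `r > 0` the defining quartic
`r⁴ − (|y⃗|² − a²) r² − a² y₃² = 0` (`Kerr.radius_quartic`) says that `y⃗` lies on the confocal
ellipsoid `(y₁² + y₂²)/(r² + a²) + y₃²/r² = 1`, whose left side is antitone in `r` and is multiplied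
by `s² > 1` under `y ↦ s • y`; the hypothesis `|a| < r_a(y) ≤ |y⃗| ≤ |s • y⃗|`
(`Kerr.radius_le_spatialNorm`) keeps `r_a(s • y) > 0` (`Kerr.radius_pos_of_abs_lt`). (Only the
spatial part of `y` enters `r_a`; the time component is dilated harmlessly.) [folklore] -/
theorem radius_lt_radius_smul {a : ℝ} {y : E4} (hy : |a| < Kerr.radius a y) {s : ℝ} (hs : 1 < s) :
    Kerr.radius a y < Kerr.radius a (s • y) := by
  have hr : 0 < Kerr.radius a y := (abs_nonneg a).trans_lt hy
  have hρ : Kerr.radius a y ≤ E4.spatialNorm y := Kerr.radius_le_spatialNorm a y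
  have hs0 : 0 < s := one_pos.trans hs
  have hsn : E4.spatialNorm (s • y) = s * E4.spatialNorm y := by
    simp only [E4.spatialNorm, map_smul, norm_smul, Real.norm_eq_abs, abs_of_pos hs0]
  have hs3 : (s • y) 3 = s * y 3 := by simp
  have hr' : 0 < Kerr.radius a (s • y) := by
    refine Kerr.radius_pos_of_abs_lt ?_
    rw [hsn]; nlinarith [mul_nonneg (sub_nonneg.2 hs.le) (E4.spatialNorm_nonneg y)]
  -- `P = r_a(y)²`, `Q = r_a(s • y)²` and the two quartics
  obtain ⟨P, hP⟩ : ∃ P : ℝ, P = Kerr.radius a y ^ 2 := ⟨_, rfl⟩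
  obtain ⟨Q, hQ⟩ : ∃ Q : ℝ, Q = Kerr.radius a (s • y) ^ 2 := ⟨_, rfl⟩
  have hP0 : 0 < P := by rw [hP]; positivity
  have hQ0 : 0 < Q := by rw [hQ]; positivity
  have hI : P ^ 2 - (E4.spatialNorm y ^ 2 - a ^ 2) * P - a ^ 2 * y 3 ^ 2 = 0 := by
    rw [hP]; linear_combination Kerr.radius_quartic a y
  have h4 := Kerr.radius_quartic a (s • y)
  rw [hsn, hs3] at h4
  have hII :
      Q ^ 2 - (s ^ 2 * E4.spatialNorm y ^ 2 - a ^ 2) * Q - a ^ 2 * (s ^ 2 * y 3 ^ 2) = 0 := by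
    rw [hQ]; linear_combination h4
  by_contra hle
  rw [not_lt] at hle
  have hQP : Q ≤ P := by rw [hP, hQ]; exact pow_le_pow_left₀ hr'.le hle 2
  -- `h(t) = (ρ² − z²) t + z² (t + a²) − t (t + a²)` vanishes at `P` and is `≥ 0` on `[0, P]`:
  -- `P · h(Q) = (P − Q)(P Q + z² a²)`
  have h1 : P * ((E4.spatialNorm y ^ 2 - y 3 ^ 2) * Q + y 3 ^ 2 * (Q + a ^ 2) - Q * (Q + a ^ 2)) =
      (P - Q) * (P * Q + y 3 ^ 2 * a ^ 2) := by linear_combination (-Q) * hI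
  have h2 : 0 ≤ (P - Q) * (P * Q + y 3 ^ 2 * a ^ 2) :=
    mul_nonneg (sub_nonneg.2 hQP) (by positivity)
  have h3 : 0 ≤ (E4.spatialNorm y ^ 2 - y 3 ^ 2) * Q + y 3 ^ 2 * (Q + a ^ 2) - Q * (Q + a ^ 2) := by
    rw [← h1] at h2
    exact (mul_nonneg_iff_of_pos_left hP0).1 h2
  -- but the quartic at `s • y` reads `Q (Q + a²) = s² (h(Q) + Q (Q + a²))` with `s² > 1`
  have hs2 : 1 < s ^ 2 := by nlinarith
  have hQa : 0 < Q * (Q + a ^ 2) := by positivity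
  nlinarith [mul_pos (sub_pos.2 hs2) hQa, mul_nonneg (sq_nonneg s) h3]

/-- **Flatness on the open exterior slab extends to the closed slab.** Let `(M, a)` be
sub-extremal and `g` of class `Cᵏ` on the star domain `(starBackground Λ c M a rf).domain`. If all
derivatives of `g` of order `≤ k` vanish on the exterior time-zero slab
`{t* = 0} ∩ {r > max r₊ 0}` of `boostedKerrBackground Λ c M a` (the conclusion of the dictionary's
forward direction `iteratedFDeriv_omegaLimit_eq_zero_of_tendsto_supCkENorm_truncTimeSlab` there),
then they vanish at every `x` with `t*(x) = 0` and `r(Λ⁻¹(x − c)) ≥ r₊`: a horizon point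
`x = Λ y + c`, `y⁰ = 0`, `r_a(y) = r₊ > M > |a|`, is the limit as `s ↓ 1` of the points
`Λ (s • y) + c` of the open slab (`radius_lt_radius_smul`), and `D^m g` is continuous at `x`, an
interior point of the star domain (`ContDiffAt.continuousAt_iteratedFDeriv`). [folklore] -/
theorem iteratedFDeriv_eq_zero_closedSlab_of_eq_zero_timeSlab {W : Type*} [NormedAddCommGroup W]
    [NormedSpace ℝ W] (Λ : lorentzGroup) (c : E4) {M a : ℝ} (hMa : Kerr.IsSubextremal M a)
    (rf : E4 → ℝ) {k : ℕ} {g : E4 → W}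
    (hg : ContDiffOn ℝ k g ((starBackground Λ c M a rf).domain : Set E4))
    (hflat : ∀ x ∈ Subtype.val '' (boostedKerrBackground Λ c M a).timeSlab 0, ∀ m, m ≤ k →
      iteratedFDeriv ℝ m g x = 0) :
    ∀ x : E4, poincareInv Λ c x 0 = 0 → Kerr.rPlus M a ≤ Kerr.radius a (poincareInv Λ c x) →
      ∀ m, m ≤ k → iteratedFDeriv ℝ m g x = 0 := by
  intro x hx0 hxr m hm
  -- rest-frame coordinates `y` of `x`, and the dilated points `φ s = Λ (s • y) + c`
  obtain ⟨y, hy⟩ : ∃ y : E4, poincareInv Λ c x = y := ⟨_, rfl⟩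
  rw [hy] at hx0 hxr
  have hya : |a| < Kerr.radius a y :=
    (lt_of_lt_of_le (show |a| < M from hMa) hMa.M_lt_rPlus.le).trans_le hxr
  have hxeq : (Λ : E4 ≃L[ℝ] E4) y + c = x := by
    rw [← hy]
    simp [poincareInv]
  obtain ⟨φ, hφ⟩ : ∃ φ : ℝ → E4, φ = fun s ↦ (Λ : E4 ≃L[ℝ] E4) (s • y) + c := ⟨_, rfl⟩
  have hφc : Continuous φ :=
    hφ ▸ ((Λ : E4 ≃L[ℝ] E4).continuous.comp (continuous_id.smul continuous_const)).add
      continuous_const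
  have hφ1 : φ 1 = x := by
    rw [hφ, ← hxeq]
    simp
  have hpφ : ∀ s : ℝ, poincareInv Λ c (φ s) = s • y := fun s ↦ by
    rw [hφ]
    simp [poincareInv]
  -- for `s > 1` the dilated points lie in the open exterior slab `{t* = 0, r > max r₊ 0}`
  have hmem : ∀ s : ℝ, 1 < s → φ s ∈ Subtype.val '' (boostedKerrBackground Λ c M a).timeSlab 0 := by
    intro s hs
    have hsr : Kerr.rPlus M a < Kerr.radius a (poincareInv Λ c (φ s)) :=
      (hpφ s).symm ▸ hxr.trans_lt (radius_lt_radius_smul hya hs)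
    have hsd : φ s ∈ (boostedKerrBackground Λ c M a).domain := by
      show poincareInv Λ c (φ s) ∈ Kerr.exterior M a
      rw [Kerr.mem_exterior]
      exact max_lt hsr (hMa.rPlus_pos.trans hsr)
    refine ⟨⟨φ s, hsd⟩, ?_, rfl⟩
    show poincareInv Λ c (φ s) 0 = 0
    rw [hpφ]
    simp [hx0]
  -- `x` is in the closure of the open slab
  have hxcl : x ∈ closure (Subtype.val '' (boostedKerrBackground Λ c M a).timeSlab 0) := by
    refine mem_closure_of_tendsto (b := 𝓝[>] (1 : ℝ)) ?_ (eventually_nhdsWithin_of_forall hmem)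
    rw [← hφ1]
    exact (hφc.tendsto 1).mono_left nhdsWithin_le_nhds
  -- `D^m g` is continuous at `x` (the star domain is an open neighbourhood of `x`)
  have hxO : x ∈ ((starBackground Λ c M a rf).domain : Set E4) := by
    rw [SetLike.mem_coe, mem_starBackground_domain, Kerr.mem_region, max_eq_left hMa.pos.le, hy]
    exact hMa.M_lt_rPlus.trans_le hxr
  have hcont : ContinuousAt (iteratedFDeriv ℝ m g) x :=
    (hg.contDiffAt ((starBackground Λ c M a rf).domain.isOpen.mem_nhds hxO))
      |>.continuousAt_iteratedFDeriv (by exact_mod_cast hm)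
  -- a continuous function vanishing on a set vanishes on its closure
  have himg : iteratedFDeriv ℝ m g '' (Subtype.val '' (boostedKerrBackground Λ c M a).timeSlab 0) ⊆
      {0} := by
    rintro _ ⟨z, hz, rfl⟩
    exact hflat z hz m hm
  have h0 : iteratedFDeriv ℝ m g x ∈ closure ({0} : Set _) :=
    closure_mono himg (hcont.continuousWithinAt.mem_closure_image hxcl)
  rwa [closure_singleton, mem_singleton_iff] at h0

/-! ### The equivalence on margin charts, and the registered converse -/

/-- **Recurrence at every exterior radius along `T` iff the ω-limit along `T` is flat to order `k`
on the exterior time-zero slab — on horizon-penetrating (star) charts.** Let `(M, a)` be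
sub-extremal, `h : E4 → W` of class `C^{k+1}` and `g` of class `Cᵏ` on the star domain
`(starBackground Λ c M a rf).domain = {r(Λ⁻¹(x − c)) > max M 0}` (any radius parameter `rf`), and
suppose the translates `h (· + T n • Λ∂₀)` converge to `g` in `Cᵏ` on every compact subset of the
star domain. Then the `Cᵏ` sup norms of the translates over every exterior truncated slab
`{t* = 0, r ≤ R'}` of `boostedKerrBackground Λ c M a` tend to `0` along `T` (for the deviation field
of a hole chart this is, through `truncDeviationCk_eq_supCkENorm_translate`, the crux's recurrence
`truncDeviationCk … R' (T n) → 0` at every radius) if and only if all derivatives of `g` of order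
`≤ k` vanish on the exterior time-zero slab `{t* = 0} ∩ {r > max r₊ 0}`.
Forward: the dictionary's `iteratedFDeriv_omegaLimit_eq_zero_of_tendsto_supCkENorm_truncTimeSlab`
on `boostedKerrBackground` (the boosted exterior is `Λ∂₀`-invariant and lies in the star domain,
`boostedKerrExterior_le_starBackground_domain`, so its compacts are compacts of the star domain).
Backward: flatness extends to the closed slab `{t* = 0, r ≥ r₊}`
(`iteratedFDeriv_eq_zero_closedSlab_of_eq_zero_timeSlab`); the closed truncated slab
`K = {t* = 0, r₊ ≤ r ≤ R'}` is compact (`isCompact_closedTruncSlab`) and lies in the open,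
`Λ∂₀`-invariant star domain (`closedTruncSlab_subset_starBackground_domain`,
`add_smul_mem_starBackground_domain`), so the dictionary's converse
`tendsto_supCkENorm_translate_of_iteratedFDeriv_omegaLimit_eq_zero` gives `Cᵏ`-smallness of the
translates on `K`, and the exterior truncated slab is a subset of `K`
(`image_truncTimeSlab_subset_closedTruncSlab`), which only LOWERS the sups (`supCkENorm_mono`). This
resolves, for charts defined across the horizon, the asymmetry of the dictionary on the bare
exterior chart (LaSalle: the orbit recurs to the reference configuration along `T` iff the latter
is the ω-limit along `T`; Hale 1980, Ch. I, §8; DR 2008, §5.1). [cite: Hale1980, Ch. I §8] -/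
theorem tendsto_supCkENorm_truncTimeSlab_translate_iff_iteratedFDeriv_eq_zero_timeSlab
    {W : Type*} [NormedAddCommGroup W] [NormedSpace ℝ W] (Λ : lorentzGroup) (c : E4) {M a : ℝ}
    (hMa : Kerr.IsSubextremal M a) (rf : E4 → ℝ) {k : ℕ} {h : E4 → W}
    (hh : ContDiffOn ℝ (k + 1) h ((starBackground Λ c M a rf).domain : Set E4)) {g : E4 → W}
    (hg : ContDiffOn ℝ k g ((starBackground Λ c M a rf).domain : Set E4)) {T : ℕ → ℝ}
    (hlim : ∀ K ⊆ ((starBackground Λ c M a rf).domain : Set E4), IsCompact K →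
      Tendsto (fun n ↦ supCkENorm K k (fun x ↦
        h (x + T n • (Λ : E4 ≃L[ℝ] E4) (EuclideanSpace.single (0 : Fin 4) (1 : ℝ))) - g x))
        atTop (𝓝 0)) :
    (∀ R' : ℝ, Tendsto (fun n ↦
        supCkENorm (Subtype.val '' (boostedKerrBackground Λ c M a).truncTimeSlab R' 0) k
          (fun x ↦ h (x + T n • (Λ : E4 ≃L[ℝ] E4) (EuclideanSpace.single (0 : Fin 4) (1 : ℝ)))))
        atTop (𝓝 0)) ↔
      ∀ x ∈ Subtype.val '' (boostedKerrBackground Λ c M a).timeSlab 0, ∀ m, m ≤ k →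
        iteratedFDeriv ℝ m g x = 0 := by
  constructor
  · intro hrec
    -- the boosted exterior lies in the star domain: restrict everything to it
    have hsub : ((boostedKerrBackground Λ c M a).domain : Set E4) ⊆
        ((starBackground Λ c M a rf).domain : Set E4) :=
      SetLike.coe_subset_coe.2 (boostedKerrExterior_le_starBackground_domain Λ c M a rf)
    exact iteratedFDeriv_omegaLimit_eq_zero_of_tendsto_supCkENorm_truncTimeSlab
      (boostedKerrBackground Λ c M a)
      ((Λ : E4 ≃L[ℝ] E4) (EuclideanSpace.single (0 : Fin 4) (1 : ℝ)))
      (add_smul_mem_boostedKerrBackground_domain Λ c M a) (hh.mono hsub) (hg.mono hsub)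
      (fun K hKO hK ↦ hlim K (hKO.trans hsub) hK) hrec
  · intro hflat R'
    -- flatness on the closed slab `{t* = 0, r ≥ r₊}`
    have hflat' := iteratedFDeriv_eq_zero_closedSlab_of_eq_zero_timeSlab Λ c hMa rf hg hflat
    -- the closed slab `K = {t* = 0, r₊ ≤ r ≤ R'}`: compact, inside the open invariant star domain
    obtain ⟨K, hKdef⟩ : ∃ K : Set E4, K = {x : E4 | poincareInv Λ c x 0 = 0 ∧
        Kerr.rPlus M a ≤ Kerr.radius a (poincareInv Λ c x) ∧
          Kerr.radius a (poincareInv Λ c x) ≤ R'} := ⟨_, rfl⟩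
    have hK : IsCompact K := hKdef ▸ isCompact_closedTruncSlab Λ c M a 0 R'
    have hKO : K ⊆ ((starBackground Λ c M a rf).domain : Set E4) :=
      hKdef ▸ closedTruncSlab_subset_starBackground_domain Λ c hMa rf 0 R'
    have hflatK : ∀ x ∈ K, ∀ m, m ≤ k → iteratedFDeriv ℝ m g x = 0 := by
      intro x hx m hm
      rw [hKdef] at hx
      exact hflat' x hx.1 hx.2.1 m hm
    -- the dictionary's converse on `K`
    have hKlim : Tendsto (fun n ↦ supCkENorm K k (fun x ↦
        h (x + T n • (Λ : E4 ≃L[ℝ] E4) (EuclideanSpace.single (0 : Fin 4) (1 : ℝ)))))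
        atTop (𝓝 0) :=
      tendsto_supCkENorm_translate_of_iteratedFDeriv_omegaLimit_eq_zero
        (starBackground Λ c M a rf).domain.isOpen
        ((Λ : E4 ≃L[ℝ] E4) (EuclideanSpace.single (0 : Fin 4) (1 : ℝ)))
        (add_smul_mem_starBackground_domain Λ c M a rf) hh hg hKO (hlim K hKO hK) hflatK
    -- the exterior truncated slab is a subset of `K`: its sups are smaller
    have hKsub : Subtype.val '' (boostedKerrBackground Λ c M a).truncTimeSlab R' 0 ⊆ K :=
      hKdef ▸ image_truncTimeSlab_subset_closedTruncSlab Λ c M a R' 0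
    exact tendsto_of_tendsto_of_tendsto_of_le_of_le' tendsto_const_nhds hKlim
      (Eventually.of_forall fun _ ↦ zero_le)
      (Eventually.of_forall fun n ↦ supCkENorm_mono hKsub k _)

/-- **Registered structure stub (crux stmt-FinalStateConjecture-14664, line `Sketch`, stub
`PenetratingSlab`): on a horizon-penetrating (star) chart, an ω-limit along `T` that is flat to
order `k` on the CLOSED time-zero exterior slab gives back recurrence at EVERY exterior radius
along `T`.** Let `(M, a)` be sub-extremal, `h : E4 → W` of class `C^{k+1}` and `g` of class `Cᵏ` on
the star domain `(starBackground Λ c M a rf).domain = {r(Λ⁻¹(x − c)) > max M 0}` (any radius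
parameter `rf`), and `T n` times along which the translates `h (· + T n • Λ∂₀)` converge to `g` in
`Cᵏ` on every compact subset of the star domain. If all derivatives of `g` of order `≤ k` vanish at
the points `x` with `t*(x) = 0` and `r(Λ⁻¹(x − c)) ≥ r₊`, then for every `R'` the `Cᵏ` sup norm of
the translates over the exterior truncated slab `{t* = 0, r ≤ R'}` of
`boostedKerrBackground Λ c M a` tends to `0` along `T` (for the deviation field of a hole chart: the
crux's recurrence `truncDeviationCk … R' (T n) → 0` at every radius). The converse of
`iteratedFDeriv_omegaLimit_eq_zero_of_tendsto_supCkENorm_truncTimeSlab`, which fails on the bare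
exterior chart (`{t* = 0, r₊ < r ≤ R'}` is not compact in the open exterior); here it is the
backward direction of the equivalence
`tendsto_supCkENorm_truncTimeSlab_translate_iff_iteratedFDeriv_eq_zero_timeSlab` (the closed-slab
hypothesis restricted to the open exterior slab, whose points have `r ≥ r₊`). Hale 1980, Ch. I,
§8; Dafermos–Rodnianski 2008, §5.1. Closed form. [cite: Hale1980, Ch. I §8] -/
theorem tendsto_supCkENorm_truncTimeSlab_translate_of_iteratedFDeriv_eq_zero_closedSlab :
    ∀ {W : Type*} [NormedAddCommGroup W] [NormedSpace ℝ W] (Λ : lorentzGroup) (c : E4) {M a : ℝ},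
      Kerr.IsSubextremal M a →
      ∀ (rf : E4 → ℝ) {k : ℕ} {h : E4 → W},
      ContDiffOn ℝ (k + 1) h ((starBackground Λ c M a rf).domain : Set E4) →
      ∀ {g : E4 → W}, ContDiffOn ℝ k g ((starBackground Λ c M a rf).domain : Set E4) →
      ∀ {T : ℕ → ℝ},
      (∀ K ⊆ ((starBackground Λ c M a rf).domain : Set E4), IsCompact K →
        Tendsto (fun n ↦ supCkENorm K k (fun x ↦
          h (x + T n • (Λ : E4 ≃L[ℝ] E4) (EuclideanSpace.single (0 : Fin 4) (1 : ℝ))) - g x))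
          atTop (𝓝 0)) →
      (∀ x : E4, poincareInv Λ c x 0 = 0 → Kerr.rPlus M a ≤ Kerr.radius a (poincareInv Λ c x) →
        ∀ m, m ≤ k → iteratedFDeriv ℝ m g x = 0) →
      ∀ R' : ℝ, Tendsto (fun n ↦
        supCkENorm (Subtype.val '' (boostedKerrBackground Λ c M a).truncTimeSlab R' 0) k
          (fun x ↦ h (x + T n • (Λ : E4 ≃L[ℝ] E4) (EuclideanSpace.single (0 : Fin 4) (1 : ℝ)))))
        atTop (𝓝 0) := by
  intro W _ _ Λ c M a hMa rf k h hh g hg T hlim hflat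
  refine (tendsto_supCkENorm_truncTimeSlab_translate_iff_iteratedFDeriv_eq_zero_timeSlab Λ c hMa
    rf hh hg hlim).2 ?_
  -- points of the open exterior slab have `t* = 0` and `r > r₊`
  rintro _ ⟨y, hy, rfl⟩ m hm
  have hy2 : poincareInv Λ c y ∈ Kerr.region a (Kerr.rPlus M a) := y.2
  exact hflat y hy (Kerr.lt_radius_of_mem_region hy2).le m hm

end Summit.FinalStateConjecture.FinalStateConjecture.Theorems.ClusterCompleteness

end
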